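import Summits.QuantumFields.YangMills.Theorems.UnitScaleTiltHalvingHSiteRowsOfSocketsTGammaR
import Summits.QuantumFields.YangMills.Theorems.UnitScaleTiltHalvingTopCrossingQkOfDefect
import HarnessLib

/-!
# Line H (`BirthV10.stub_halvingStep`, stmt-QuantumFields-19200), THIN ROAD γ, (M2′): ★★★ THE ASSEMBLY — the displayed residual `H42topCrossT` ((1.42) at the COLLAR top
# bonds of print's class, ∀(u, V′, A′)-closed) from the (a-row) «κf ↔ (84)(86) DICTIONARY» and the (b-row) «fat-loop STOKES bound», over ★w5-20520 g9's `ℤᵈ` spine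
# ✓`HalvingTopCrossingQkOfDefect` (the defect edition of lit ✓`B8Eq142KLevelLocalGamma.H42_of_inAx_γ`'s crossing branch)
Cell `ym3-torus` (HUMAN RULING D-0037: YM₃ on T³ is ladder rung R3 — NOT d = 4, NOT a mass gap, NOT the Clay problem), width seat `ym-ust-19200-w8` gen 9 (LEAD-H ★w5-19200 g7
WORD 13); statement, binders (a) 84fa2ca8 ∕ (b) d2f54740 and plan by ★w3-20520 g8; his two PROVISIONAL window rows `hchart`∕`hc₃` replaced by the composer's γ rows `hα3γ hα4γ
hsmallPγ hc₃Pγ` ([3] Prop. 4 at `(L²ε₀, L·α₂)`, as ✓`H42_of_rows_γD`), nothing else changed.  `--supports stmt-QuantumFields-19200 --as helper`; THEOREMS ONLY (0 `def`, 0 `sorry`);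
count-neutral; nothing here claims the packs' sockets, the stub, the crux or the gap.
* §0 `norm_sub_one_le_of_mul_right` (`‖U·E − 1‖ ≤ s`, `‖E − 1‖ ≤ θ ≤ ½` ⇒ `‖U − 1‖ ≤ s + 2θ(1+s)`); `under_or_under_of_bondBox` (a bond box is the union of its two blocks).
* §1 ★★ `H42cross_of_defect` — GENERIC (lit letters, `d ≥ 2`, C⋆-algebra, flat background): datum `U′` axial in every tower with (1.35)@`k`; gauge `u` with print's (1.29) below
  the top and a DEFECT `θ` on `□_k^{(k)}`; `mgauge 1 u V′ = U′` on every class bond's box; `V′ = e^{ηA′}` with sizes `α₂(Lʲη)⁻¹` on sides touching `□_j` ⇒ (1.42) on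
  `cubeLamBP′…k k k ∖ cubeLamB…k k k`: trichotomy ✓`cubeLamBP'_hclass` (inner alternative excluded — its box lies in `□_k`), outer end `= 1` by ✓`uavg_succ_eq_one_of_restr129_box`,
  tower axiality transferred by lit ✓`tHol_block_congr`, (1.35) by ✓`avgIter_congr`, then ✓`norm_logCovIter_succ_lt_crossing_of_defect_loc`.
* §2 ★★★ `h42topCrossT_of_dictionary_and_stokes` — §1 at the knit gauge `u := u₁·e^{lam}`, `U′ := pull (U^{gJ})♯ 0`: local agreement from the closure's KNIT clause
  (✓`gaugeActT_descent_eq_of_mgauge_cube` read backwards), (1.35) from J3's guard (d) via ✓`h135_cubeMember_γ`, defect `θ := θa + 2θb(1+θa)` from (a) ⊕ `htopId` ⊕ (b) by §0.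
HONEST SCOPE.  Wiring + one norm estimate; (a)∕(b) are HYPOTHESES (suppliers ym-ust-20520-w5 g9 ∕ ★w3-19200 g10); nothing of [4] Prop. 3∕5, Thm 4, the stub or the crux is proved.
References: T. Bałaban, CMP **99** (1985) 75–102 [Balaban1985RegularSpaces] ((1.29)–(1.31) pp.81–82, (1.35), (1.37) p.82, (1.42) p.83, (1.131) p.99); CMP **98** (1985) 17–51
[Balaban1985Averaging] ((55) p.27, (84)–(87) pp.30–31, (92) p.31, (127) p.37, Prop. 4 pp.38–39); CMP **102** (1985) 277–309 [Balaban1985Variational] ((152) p.301).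
-/

set_option autoImplicit false

noncomputable section

open scoped BigOperators Matrix.Norms.L2Operator
open NormedSpace  open Complex (I)

namespace Summit.QuantumFields.YangMills.Theorems.HalvingH42TopCrossAssembly

open Literature.MathematicalPhysics.QuantumFieldTheory.Balaban1983to89  open Literature.MathematicalPhysics.QuantumFieldTheory.Balaban1983to89.T3ContinuumYM3Torus
open Literature.MathematicalPhysics.QuantumFieldTheory.Balaban1983to89.T3PrintedRegularMinimiser (RegPr regFibrePr)  open MatrixLog (mlog)  open B5Eq118OneStroke (iterBlockOf)  open B7Prop1Explicit (e expUnit)  open B7Prop1Explicit renaming Site → LSite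
open B7Prop2Explicit (unitaryUnits C0 c2' avgIter)  open B7Prop2SpecialUnitary (specialUnitaryUnits mem_specialUnitaryUnits specialUnitaryUnits_le_unitaryUnits)  open B7Prop3Flat (c3)  open B7Prop10General (C6 C4G)  open B7Prop9Flat (C5')  open B7Prop1Local (InBox loK bondHiK)
open B7Eq78Linearization (conjR zdBlocking QprimeIter)  open B7Eq92Concrete (mgauge)  open B8Ineq130 (tlo thi)  open B8Ineq132 (covDerivFwd InAk)
open B8Eq119TwistedAxial (Restr129 InAx bgT)  open B8Eq131Cubes (cube gs tLo tHi)  open B8Eq131CubesAdmissible (cubeFam)  open B8CubeMemberZd (cubeLamS cubeLamB)  open B8Eq184Proof (gaugeExp cfgExp)  open B8Eq182Proof (gAd)  open B8Eq188Proof (frakF3)  open B8Eq140Level (SideTouches)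
open B8Eq146AExpansion (iEta)  open B8Eq138LandauZd (IsLandau138W covDivB covLap QT logCfg)  open B7Prop4GeneralLevels (logCovIter linCovIter)  open B8Eq155JBound (Jcur wsup)  open B8ScaledSupNorm (bondNorm msup)  open B8Ineq125Concrete (C2p)
open B8Eq1117Concrete (XSpace)  open B9SupplySockB9P3ZdBeta (CrossB)  open B9SupplySockB9P3ZdGamma (cubeLamBP')  open B8Ineq132 (BondTouches)
open HalvingHSiteDatumRowsGamma (datumRowsγ h66_of_towerRow betaScalarRows)  open B8Prop5ContractionKLevel (Bd2 Mc Kc)  open B8LambdaSpaceKLevel (wt)  open B8Eq178Averages (Qnl)  open B8SpecialUnitaryTrace (trCLM trCLM_apply)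
open B10Eq27TorusAxialLog (transl rel pull pull_apply unitsField toUField suIncl gaugeActT axialT unitsField_mem_unitaryUnits)  open B15Eq112TorusCover (lift cover)  open Node00 (coverAt)
open LatticeFieldCalculus (siteAvgIter)  open Summit.QuantumFields.YangMills.Theorems.Prop8ChartDoubleBar (dbarIterU vframeU)  open P1FlatCoreCubeInclusion (corner_of_offset)  open HalvingP1FlatCoreSupplierAssembly (hchartTop_of_hdat hc₁_of_small)
open HalvingHSiteSizeRowsOfTopRowsGamma (siteSizeRows_of_topRows_γ)  open HalvingHSiteTopKnit (hknit_of_descent)  open HalvingHSiteDatumOfSocketsTGammaTree (siteDatum_of_T4Tγ_tree)  open B8Lemma1NonAbelian (lowPart)  open HalvingHSiteTopH42OfRowsGammaD (H42_of_rows_γD)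
open HalvingHSiteTopKnitBP (hknit_of_descent_BP')  open B8CubeMemberZd (hΩ_cubeFam)  open B8SockHFPCubeMember (htw_cubeLamS h8lt_cubeLamS h8top_cubeLamS)  open B8Prop6OfThm4 (one_inAk)
open HalvingP1FlatCoreSupplierRestr129 (restr129_product_of_topRows)  open HalvingP1FlatCoreSupplierInduction (h34_of_inAk_univ hAx_of_inAx_one)  open B8Prop5SocketDatum (restr129_succ_of_truncation)  open P1FlatCoreTopH42Gamma (cubeLamB_top_subset_cubeLamBP')  open B7Prop4Flat (C2 c4)  open HalvingHSiteTopOfDatumGamma (siteTop_of_datum_γ)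

open B7Prop5Flat (BondIn)  open B7Prop1Local (AgreeOn)  open B7Eq92Concrete (tildIter tildIter_apply tHol)  open B7Eq84Concrete (uavg)
open B7Prop1Explicit (treeWord boxVec)  open B8Ineq132 (Under avgIter_one)  open B8Eq131Derivation (ax119_iff_ax67)  open B8Ineq172Concrete (tHol_block_congr)
open B8Eq142KLevelLocal (inBox_box_of_tower_fst inBox_box_of_tower_snd)  open B8CubeMemberLamBPrimeLaws (cubeLamBP'_hbox_pred cubeLamBP'_hclass)
open B8Eq131CubesAdmissible (cubeFam_false_of_le)  open B8CubeMemberZd (cubeLamS_self)  open B8Eq131Cubes (mem_cube_iff cube_anti)  open B8Eq140Level (sideTouches_of_bondTouches)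
open B7Prop1Local (avgIter_congr)  open B7Prop3Flat (expCfg)
open HalvingTopCrossingQkOfDefect (norm_logCovIter_succ_lt_crossing_of_defect_loc uavg_succ_eq_one_of_restr129_box agreeOn_of_subbox)
open HalvingHSiteTopRowsOfSocketsGamma (h135_cubeMember_γ)  open P1FlatCoreTopTargetRep (rep_cover_eq_of_mem_cube)  open HalvingP1FlatCoreSupplierGaugeDescent (gaugeActT_mul_left)
open HalvingCompetitorMapFibre (unitsField_toUField_gaugeAct)  open P1FlatCoreCubeInclusion (transl_zero_eq_cover)  open B10Eq27TorusAxialLog (transl_add_e)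
open B7Eq92Concrete (mgauge_apply Rc_one_apply)  open Summit.QuantumFields.YangMills.Theorems (FlatMinimizerH.le_T3)

section Algebra

variable {𝔸 : Type*} [NormedRing 𝔸] [NormOneClass 𝔸]

/-- **RIGHT DEFECT FACTOR**: units `U, E` with `‖U·E − 1‖ ≤ s`, `‖E − 1‖ ≤ θ ≤ ½` give `‖U − 1‖ ≤ s + 2θ(1 + s)` (`U = (U·E)·E⁻¹`, `‖E⁻¹ − 1‖ ≤ 2θ` by
`r ≤ (r+1)θ`; the mirror of ✓`HalvingTopCrossingQkOfDefect.norm_inv_mul_mul_sub_one_le`). [folklore] -/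
theorem norm_sub_one_le_of_mul_right {U E : 𝔸ˣ} {s θ : ℝ} (hs0 : 0 ≤ s) (hθ : θ ≤ 1 / 2)
    (hT : ‖(U : 𝔸) * (E : 𝔸) - 1‖ ≤ s) (hE : ‖(E : 𝔸) - 1‖ ≤ θ) : ‖(U : 𝔸) - 1‖ ≤ s + 2 * θ * (1 + s) := by
  set r : ℝ := ‖((E⁻¹ : 𝔸ˣ) : 𝔸) - 1‖ with hr
  have hr0 : 0 ≤ r := norm_nonneg _
  have h1 : ‖((E⁻¹ : 𝔸ˣ) : 𝔸)‖ ≤ r + 1 := by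
    calc ‖((E⁻¹ : 𝔸ˣ) : 𝔸)‖ = ‖(((E⁻¹ : 𝔸ˣ) : 𝔸) - 1) + 1‖ := by rw [sub_add_cancel]
      _ ≤ ‖((E⁻¹ : 𝔸ˣ) : 𝔸) - 1‖ + ‖(1 : 𝔸)‖ := norm_add_le _ _
      _ = r + 1 := by rw [norm_one]
  have hr1 : r ≤ (r + 1) * θ := by
    have hid : ((E⁻¹ : 𝔸ˣ) : 𝔸) - 1 = ((E⁻¹ : 𝔸ˣ) : 𝔸) * (1 - (E : 𝔸)) := by rw [mul_sub, mul_one, Units.inv_mul]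
    calc r = ‖((E⁻¹ : 𝔸ˣ) : 𝔸) * (1 - (E : 𝔸))‖ := by rw [hr, hid]
      _ ≤ ‖((E⁻¹ : 𝔸ˣ) : 𝔸)‖ * ‖1 - (E : 𝔸)‖ := norm_mul_le _ _
      _ ≤ (r + 1) * θ := mul_le_mul h1 (by rwa [norm_sub_rev]) (norm_nonneg _) (by positivity)
  have hr2 : r ≤ 2 * θ := by nlinarith
  have hid : (U : 𝔸) - 1 = ((U : 𝔸) * (E : 𝔸) - 1) * ((E⁻¹ : 𝔸ˣ) : 𝔸) + (((E⁻¹ : 𝔸ˣ) : 𝔸) - 1) := by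
    rw [sub_mul, mul_assoc, Units.mul_inv, mul_one, one_mul]; abel
  rw [hid]
  calc ‖((U : 𝔸) * (E : 𝔸) - 1) * ((E⁻¹ : 𝔸ˣ) : 𝔸) + (((E⁻¹ : 𝔸ˣ) : 𝔸) - 1)‖
      ≤ ‖((U : 𝔸) * (E : 𝔸) - 1) * ((E⁻¹ : 𝔸ˣ) : 𝔸)‖ + ‖((E⁻¹ : 𝔸ˣ) : 𝔸) - 1‖ := norm_add_le _ _
    _ ≤ s * (r + 1) + r := by gcongr; exact (norm_mul_le _ _).trans (mul_le_mul hT h1 (norm_nonneg _) hs0)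
    _ ≤ s + 2 * θ * (1 + s) := by nlinarith

end Algebra

section Generic

variable {d : ℕ}

/-- The fine box `Bʲ(z) ∪ Bʲ(z + e_μ)` of a level-`j` bond is the union of its two `j`-blocks (lit `B8TowerBondsNonempty.under_or_of_bondBox`, restated here to keep the
import list short). [cite: Balaban1985Averaging, p.24 (sentence after (43)); Balaban1985RegularSpaces, (1.6) p.77] -/
theorem under_or_under_of_bondBox {L j : ℕ} {z : LSite d} {μ : Fin d} {x : LSite d} (hx : InBox (loK L j z) (bondHiK L j z μ) x) :
    Under L j z x ∨ Under L j (z + e μ) x := by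
  by_cases hκ : x μ + 1 ≤ (L : ℤ) ^ j * (z μ + 1)
  · refine Or.inl fun i => ?_
    obtain ⟨h1, h2⟩ := hx i
    simp only [loK, bondHiK] at h1 h2
    by_cases hi : i = μ
    · subst hi; exact ⟨h1, hκ⟩
    · rw [if_neg hi] at h2; exact ⟨h1, by linarith⟩
  · refine Or.inr fun i => ?_
    obtain ⟨h1, h2⟩ := hx i
    simp only [loK, bondHiK] at h1 h2
    by_cases hi : i = μ
    · subst hi; rw [if_pos rfl] at h2; rw [Pi.add_apply, B7Prop1Explicit.e_apply, if_pos rfl]; constructor <;> linarith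
    · rw [if_neg hi] at h2; simp only [Pi.add_apply, B7Prop1Explicit.e_apply, if_neg hi, add_zero]; exact ⟨h1, by linarith⟩

variable {𝔸 : Type*} [CStarAlgebra 𝔸] [Nontrivial 𝔸]

/-- ★★ **THE (1.42) CLAUSE AT THE COLLAR TOP BONDS OF PRINT's CLASS FROM A DEFECT AT THE INNER END** — defect edition of lit ✓`H42_of_inAx_γ`'s crossing branch over
✓`norm_logCovIter_succ_lt_crossing_of_defect_loc` (flat background, top level `k ≥ 1`, geometry `(cubeFam false, cubeLamS, cubeLamBP′)`): `U′` axial in every tower with (1.35)@`k`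
on bonds boxed in `□_{k−1}`; `u` with (1.29) below the top and a defect `θ` on `□_k^{(k)}`; `mgauge 1 u V′ = U′` on every class bond's box; `V′ = e^{ηA′}`, sizes `α₂(Lʲη)⁻¹` on
sides touching `□_j` ⇒ `‖Q_k(1, iηA′)(c)‖ < 2dLα₁` on `cubeLamBP′…k k k ∖ cubeLamB…k k k`, under `s + 2θ(1+s) ≤ ½`, `2(s + 2θ(1+s)) < 2dLα₁`, Prop. 4 at `(L²α₀, L·α₂)`.
[cite: Balaban1985RegularSpaces, (1.42) p.83, (1.29) p.81, (1.31) p.82, (1.35) p.82, (1.37) p.82; Balaban1985Averaging, (84) p.30, (92) p.31, (127) p.37, Prop. 4 pp.38-39] -/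
theorem H42cross_of_defect (hd2 : 2 ≤ d) {η : ℝ} (hη : 0 < η) {L : ℕ} (hL : 2 ≤ L) (a : LSite d) (M' : ℕ) {ρ' : ℕ} (hρ : L ≤ ρ')
    {k : ℕ} (hk : 1 ≤ k) {α₀ α₁ α₂ : ℝ} (hα₀ : 0 < α₀) (hα₂ : 0 ≤ α₂)
    (hα3 : C0 d * ((L : ℝ) ^ 2 * α₀) ≤ 1 / 3) (hα4 : 4 * ((L : ℝ) ^ 2 * α₀) ≤ c2' d L)
    (hsmall : Real.exp (4 * (800 * ((d : ℝ) + 1) ^ 2 * ((d : ℝ) + 4)) * ((L : ℝ) ^ 2 * α₀)) * (1 + 8 * (131072 * ((d : ℝ) + 1) ^ 2) * ((L : ℝ) * α₂)) ≤ 2)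
    (hc₃ : 2 * ((L : ℝ) * α₂) ≤ c3 d L)
    (U' : LSite d → Fin d → 𝔸ˣ) (hAx : ∀ Λ : ℕ → Set (LSite d), InAx L k Λ (1 : LSite d → Fin d → 𝔸ˣ) U')
    {s θ : ℝ} (hs0 : 0 ≤ s) (hθ0 : 0 ≤ θ) (hhalf : s + 2 * θ * (1 + s) ≤ 1 / 2) (hwin : 2 * (s + 2 * θ * (1 + s)) < 2 * d * L * α₁)
    (h135 : ∀ (z : LSite d) (μ : Fin d), (∀ x, InBox (loK L k z) (bondHiK L k z μ) x → x ∈ cubeFam false L a M' ρ' k (k - 1)) →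
      ‖(avgIter L U' k z μ : 𝔸) - 1‖ ≤ s)
    (u : LSite d → 𝔸ˣ) (V' : LSite d → Fin d → 𝔸ˣ) (A' : LSite d → Fin d → 𝔸)
    (hWU : ∀ c ∈ cubeLamBP' L a M' ρ' k k k, AgreeOn (loK L k c.1) (bondHiK L k c.1 c.2) (mgauge (1 : LSite d → Fin d → 𝔸ˣ) u V') U')
    (h129 : Restr129 L k (Function.update (cubeLamS L a M' ρ' k k) k ∅) (1 : LSite d → Fin d → 𝔸ˣ) u)
    (hdef : ∀ y ∈ cubeLamS L a M' ρ' k k k, ‖(uavg L (1 : LSite d → Fin d → 𝔸ˣ) u k y : 𝔸) - 1‖ ≤ θ)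
    (hWA : ∀ j, j ≤ k → ∀ y τ, SideTouches (cubeFam false L a M' ρ' k j) y τ → V' y τ = cfgExp η A' y τ ∧ ‖A' y τ‖ ≤ α₂ * ((L : ℝ) ^ j * η)⁻¹) :
    ∀ c ∈ cubeLamBP' L a M' ρ' k k k, c ∉ cubeLamB L a M' ρ' k k k →
      ‖logCovIter L (1 : LSite d → Fin d → 𝔸ˣ) (iEta η A') k c.1 c.2‖ < 2 * d * L * α₁ := by
  intro c hc hnot
  have hL1 : 1 ≤ L := le_trans (by norm_num) hL
  have hLr : (1 : ℝ) ≤ L := by exact_mod_cast hL1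
  have hLpos : (0 : ℝ) < L := by positivity
  obtain ⟨j', rfl⟩ : ∃ j', k = j' + 1 := ⟨k - 1, by omega⟩
  have hθ : θ ≤ 1 / 2 := by nlinarith
  have hboxP := cubeLamBP'_hbox_pred (d := d) hL1 a M' hρ (j' + 1) (j' + 1) le_rfl (j' + 1) le_rfl c hc
  have hclass := cubeLamBP'_hclass (d := d) hL1 a M' hρ (j' + 1) (j' + 1) le_rfl (j' + 1) le_rfl c hc
  have hpow1 : ((L : ℝ) ^ (j' + 1 - 1))⁻¹ ≤ (L : ℝ) * ((L : ℝ) ^ (j' + 1))⁻¹ := by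
    rw [Nat.add_sub_cancel, pow_succ, mul_inv, ← mul_assoc, mul_comm (L : ℝ), mul_assoc, mul_inv_cancel₀ hLpos.ne', mul_one]
  have hboxbond : ∀ x μ, BondIn (loK L (j' + 1) c.1) (bondHiK L (j' + 1) c.1 c.2) x μ →
      V' x μ = cfgExp η A' x μ ∧ ‖iEta η A' x μ‖ ≤ ((L : ℝ) * α₂) * ((L : ℝ) ^ (j' + 1))⁻¹ := by
    intro x μ hb
    haveI : Nontrivial (Fin d) := Fin.nontrivial_iff_two_le.2 hd2
    obtain ⟨ν, hν⟩ := exists_ne μ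
    have hs : SideTouches (cubeFam false L a M' ρ' (j' + 1) (j' + 1 - 1)) x μ :=
      sideTouches_of_bondTouches hν (Or.inl (hboxP x hb.1))
    obtain ⟨hWx, hAx'⟩ := hWA (j' + 1 - 1) (Nat.sub_le _ _) x μ hs
    refine ⟨hWx, ?_⟩
    show ‖((I : ℂ) * η) • A' x μ‖ ≤ ((L : ℝ) * α₂) * ((L : ℝ) ^ (j' + 1))⁻¹
    rw [norm_smul, norm_mul, Complex.norm_I, one_mul, Complex.norm_real, Real.norm_eq_abs, abs_of_pos hη]
    calc η * ‖A' x μ‖ ≤ η * (α₂ * ((L : ℝ) ^ (j' + 1 - 1) * η)⁻¹) := mul_le_mul_of_nonneg_left hAx' hη.le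
      _ = α₂ * ((L : ℝ) ^ (j' + 1 - 1))⁻¹ := by field_simp
      _ ≤ α₂ * ((L : ℝ) * ((L : ℝ) ^ (j' + 1))⁻¹) := mul_le_mul_of_nonneg_left hpow1 hα₂
      _ = ((L : ℝ) * α₂) * ((L : ℝ) ^ (j' + 1))⁻¹ := by ring
  have hag : AgreeOn (loK L (j' + 1) c.1) (bondHiK L (j' + 1) c.1 c.2) V' (expCfg (iEta η A')) := fun x μ hx hxe => by
    rw [(hboxbond x μ ⟨hx, hxe⟩).1]
    exact (congrFun (congrFun (B8Prop3GaugeFixedKLevel.expCfg_iEta_eq_cfgExp η A') x) μ).symm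
  have hLb : (L : ℝ) ^ (j' + 1) * (((L : ℝ) * α₂) * ((L : ℝ) ^ (j' + 1))⁻¹) = (L : ℝ) * α₂ := by field_simp
  have hα₀' : 0 < (L : ℝ) ^ 2 * α₀ := by positivity
  have haxU : ∀ (y : LSite d) (m : ℕ), m < j' + 1 → ∀ w : LSite d, Under L (j' + 1 - (m + 1)) y w → ∀ r : Fin d → Fin L,
      tHol (avgIter L (1 : LSite d → Fin d → 𝔸ˣ) m) (tildIter L 1 U' m) ((L : ℤ) • w) (treeWord (boxVec L r)) = 1 := by
    intro y m hm w hw r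
    have h := hAx (fun _ => Set.univ) (j' + 1) hk le_rfl y (Set.mem_univ _) m hm w hw r
    rw [show U' = U' * 1 from (mul_one _).symm] at h
    exact (ax119_iff_ax67 L 1 U' m w r).1 h
  have haxT : ∀ (y : LSite d), (∀ x, InBox (tlo L y (j' + 1)) (thi L y (j' + 1)) x → InBox (loK L (j' + 1) c.1) (bondHiK L (j' + 1) c.1 c.2) x) →
      ∀ m, m < j' + 1 → ∀ w : LSite d, Under L (j' + 1 - (m + 1)) y w → ∀ r : Fin d → Fin L,
      tHol (avgIter L (1 : LSite d → Fin d → 𝔸ˣ) m) (tildIter L 1 (mgauge 1 u V') m) ((L : ℤ) • w) (treeWord (boxVec L r)) = 1 := by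
    intro y hsub m hm w hw r
    have h₀ : AgreeOn (tlo L y (j' + 1)) (thi L y (j' + 1)) (1 : LSite d → Fin d → 𝔸ˣ) 1 := fun _ _ _ _ => rfl
    have h₁ : AgreeOn (tlo L y (j' + 1)) (thi L y (j' + 1)) (mgauge 1 u V') U' := agreeOn_of_subbox hsub (hWU c hc)
    have hw' := (B8CubeMemberZd.inBox_tower_iff_under L (j' + 1 - (m + 1)) y w).2 hw
    rw [tHol_block_congr hL1 h₀ h₁ (show (j' + 1 - (m + 1)) + (m + 1) = j' + 1 by omega) (fun i => (hw' i).1) (fun i => (hw' i).2) r]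
    exact haxU y m hm w hw r
  have hax₁ := haxT c.1 (fun x hx => inBox_box_of_tower_fst L (j' + 1) c.1 c.2 hx)
  have hax₂ := haxT (c.1 + e c.2) (fun x hx => inBox_box_of_tower_snd (L := L) (j' + 1) c.1 c.2 hx)
  have hs : ‖(tildIter L 1 (mgauge (1 : LSite d → Fin d → 𝔸ˣ) u V') (j' + 1) c.1 c.2 : 𝔸) - 1‖ ≤ s := by
    rw [tildIter_apply, mul_one, avgIter_one, Pi.one_apply, Pi.one_apply, inv_one, mul_one,
      avgIter_congr L hL1 (j' + 1) c.1 c.2 (hWU c hc)]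
    exact h135 c.1 c.2 hboxP
  rcases hclass with ⟨hy, hyκ⟩ | ⟨j'', hjj, hblk, hyκ⟩ | ⟨j'', hjj, hy, hblk⟩
  · -- INNER bond: excluded — its box lies in `□_k`, so `c ∈ cubeLamB`
    exfalso
    refine hnot ⟨fun x hx => ?_, Or.inl ⟨hy, hyκ⟩⟩
    rw [cubeFam_false_of_le L a M' ρ' le_rfl]
    rw [cubeLamS_self] at hy hyκ
    rcases under_or_under_of_bondBox hx with h | h
    · exact (mem_cube_iff hL1).2 ⟨c.1, hy, h⟩
    · exact (mem_cube_iff hL1).2 ⟨c.1 + e c.2, hyκ, h⟩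
  · -- CROSSING: the block of `c₋` consists of level-`j'` constraint sites ⇒ `(R̄₀u)^{(k)}(c₋) = 1`; defect at `c₊`
    have hjj' : j'' = j' := by omega
    subst hjj'
    have hout : uavg L (1 : LSite d → Fin d → 𝔸ˣ) u (j'' + 1) c.1 = 1 :=
      uavg_succ_eq_one_of_restr129_box hL1 h129 (Nat.le_succ j'') c.1 fun x h1 h2 => by
        rw [Function.update_of_ne (by omega : j'' ≠ j'' + 1)]; exact hblk x h1 h2
    exact norm_logCovIter_succ_lt_crossing_of_defect_loc L hL j'' c.1 c.2 hα₀' hα3 hα4 (iEta η A') (by positivity)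
      (fun x μ hbd => (hboxbond x μ hbd).2) (by rw [hLb]; exact hsmall) (by rw [hLb]; exact hc₃) u V' hag hax₁ hax₂ hs0 hθ0 hθ hs
      (Or.inl ⟨hout, hdef _ hyκ⟩) hhalf hwin
  · -- MIRRORED CROSSING: defect at `c₋`, `(R̄₀u)^{(k)}(c₊) = 1`
    have hjj' : j'' = j' := by omega
    subst hjj'
    have hout : uavg L (1 : LSite d → Fin d → 𝔸ˣ) u (j'' + 1) (c.1 + e c.2) = 1 :=
      uavg_succ_eq_one_of_restr129_box hL1 h129 (Nat.le_succ j'') (c.1 + e c.2) fun x h1 h2 => by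
        rw [Function.update_of_ne (by omega : j'' ≠ j'' + 1)]; exact hblk x h1 h2
    exact norm_logCovIter_succ_lt_crossing_of_defect_loc L hL j'' c.1 c.2 hα₀' hα3 hα4 (iEta η A') (by positivity)
      (fun x μ hbd => (hboxbond x μ hbd).2) (by rw [hLb]; exact hsmall) (by rw [hLb]; exact hc₃) u V' hag hax₁ hax₂ hs0 hθ0 hθ hs
      (Or.inr ⟨hdef _ hy, hout⟩) hhalf hwin

end Generic

variable (F : T3Family) {n K : ℕ}

/-- ★★★ **(M2′) ASSEMBLY — `H42topCrossT` FROM THE DICTIONARY ROW (a) AND THE STOKES ROW (b)** (statement ★w3-20520 g8 7a3f80a7 with the composer's γ windows; see the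
module docstring).  Proof: §1 at the knit gauge `u₁·e^{lam}`, `U′ := pull (U^{gJ})♯ 0`, `θ := θa + 2θb(1 + θa)`.
[cite: Balaban1985RegularSpaces, (1.42) p.83, (1.29) p.81, (1.31) p.82, (1.35) p.82; Balaban1985Averaging, (84) p.30, (92) p.31, (127) p.37, Prop. 4 pp.38-39; Balaban1985Variational, (152) p.301] -/
theorem h42topCrossT_of_dictionary_and_stokes (hnK : n < K) (h2 : 2 ≤ K - n) (x₀ : Site (F.P K) 0) {a : LSite (F.P K).d} {M' ρ' : ℕ}
    (hM' : 1 ≤ M') (hρL : (F.P K).L ≤ ρ')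
    (ha : ∀ ν, a ν ≤ ((iterBlockOf (K - n) x₀ ν).val : ℤ) ∧ ((iterBlockOf (K - n) x₀ ν).val : ℤ) ≤ a ν + M' - 1)
    (hroomW : 2 * ((F.P K).L ^ (K - n) * (M' + 1) + ρ' * gs (F.P K).L (K - n)) ≤ (F.P K).sitesPerDir 0)
    (U : GaugeField (F.P K) 0 (Matrix.specialUnitaryGroup (Fin 2) ℂ))
    {ε₀ s α₁ α₄ cstar θa θb : ℝ} (hε₀ : 0 < ε₀) (hs0 : 0 ≤ s) (hθa : 0 ≤ θa) (hθb : 0 ≤ θb) (hcs0 : 0 ≤ cstar) (hα₄0 : 0 ≤ α₄)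
    (hhalf : s + 2 * (θa + 2 * θb * (1 + θa)) * (1 + s) ≤ 1 / 2)
    (hwin : 2 * (s + 2 * (θa + 2 * θb * (1 + θa)) * (1 + s)) < 2 * (F.P K).d * (F.P K).L * α₁)
    -- [3] Prop. 4's windows ONE LEVEL LOWER at `(L²ε₀, L·α₂)`, `α₂ := 2(L·c⋆) + 8α₄` — the composer's γ rows VERBATIM (✓`H42_of_rows_γD`'s `hα3γ hα4γ hsmallPγ hc₃Pγ`)
    (hα3γ : C0 (F.P K).d * (((F.P K).L : ℝ) ^ 2 * ε₀) ≤ 1 / 3) (hα4γ : 4 * (((F.P K).L : ℝ) ^ 2 * ε₀) ≤ c2' (F.P K).d (F.P K).L)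
    (hsmallPγ : Real.exp (4 * (800 * (((F.P K).d : ℝ) + 1) ^ 2 * (((F.P K).d : ℝ) + 4)) * (((F.P K).L : ℝ) ^ 2 * ε₀))
      * (1 + 8 * (131072 * (((F.P K).d : ℝ) + 1) ^ 2) * (((F.P K).L : ℝ) * (2 * ((F.P K).L * cstar) + 8 * α₄))) ≤ 2)
    (hc₃Pγ : 2 * (((F.P K).L : ℝ) * (2 * ((F.P K).L * cstar) + 8 * α₄)) ≤ c3 (F.P K).d (F.P K).L)
    -- (a-row): the κf ↔ (84)(86) DICTIONARY at the top blocks, first order with remainder `θa` (ym-ust-20520-w5 g9)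
    (hDict : ∀ (gJ : GaugeTransf (F.P K) 0 (Matrix.specialUnitaryGroup (Fin 2) ℂ)) (u₁ : LSite (F.P K).d → (Matrix (Fin 2) (Fin 2) ℂ)ˣ)
        (W : LSite (F.P K).d → Fin (F.P K).d → (Matrix (Fin 2) (Fin 2) ℂ)ˣ) (A : LSite (F.P K).d → Fin (F.P K).d → Matrix (Fin 2) (Fin 2) ℂ) (c₁ c' : ℝ)
        (κf : (Site (F.P K) 0 → Matrix (Fin 2) (Fin 2) ℂ) → (i : ℕ) → GaugeTransf (F.P K) i (Matrix (Fin 2) (Fin 2) ℂ)ˣ) (lam : LSite (F.P K).d → Matrix (Fin 2) (Fin 2) ℂ),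
      InAk (F.P K).L (K - n) (((F.L : ℝ)⁻¹) ^ (K - n)) ε₀ (fun _ => (Set.univ : Set (LSite (F.P K).d))) (pull (unitsField (toUField (GaugeField.gaugeAct gJ U))) 0) →
      (∀ m', m' ≤ K - n → ∀ Λ : ℕ → Set (LSite (F.P K).d), InAx (F.P K).L m' Λ (1 : LSite (F.P K).d → Fin (F.P K).d → (Matrix (Fin 2) (Fin 2) ℂ)ˣ) (pull (unitsField (toUField (GaugeField.gaugeAct gJ U))) 0)) →
      (∀ m', m' ≤ K - n → ∀ (x : LSite (F.P K).d) (ν : Fin (F.P K).d), tlo (F.P K).L (tLo a ρ') m' ≤ x → x + e ν ≤ thi (F.P K).L (tHi a M' ρ') m' →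
        ‖((avgIter (F.P K).L (pull (unitsField (toUField (GaugeField.gaugeAct gJ U))) 0) (K - n - m') x ν : (Matrix (Fin 2) (Fin 2) ℂ)ˣ) : Matrix (Fin 2) (Fin 2) ℂ) - 1‖ < s) →
      (∀ (x : LSite (F.P K).d) (ν : Fin (F.P K).d), tLo a ρ' ≤ x → x + e ν ≤ tHi a M' ρ' → lowPart ν (x - tLo a ρ') = 0 →
        avgIter (F.P K).L (pull (unitsField (toUField (GaugeField.gaugeAct gJ U))) 0) (K - n) x ν = 1) →
      (∀ z, ((u₁ z : (Matrix (Fin 2) (Fin 2) ℂ)ˣ) : Matrix (Fin 2) (Fin 2) ℂ) ∈ Matrix.specialUnitaryGroup (Fin 2) ℂ) →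
      mgauge (1 : LSite (F.P K).d → Fin (F.P K).d → (Matrix (Fin 2) (Fin 2) ℂ)ˣ) u₁ W = pull (unitsField (toUField (GaugeField.gaugeAct gJ U))) 0 →
      0 ≤ c' → 8 * 3800 * ((((F.P K).d + 2) * (F.P K).L : ℕ) : ℝ) ^ 2 * c' ≤ 1 → Real.exp c₁ - 1 ≤ ((F.L : ℝ)⁻¹) ^ (K - n) * c' →
      (∀ z ∈ cube (F.P K).L a M' ρ' (K - n) (K - n), ∀ ν : Fin (F.P K).d, W z ν = cfgExp (((F.L : ℝ)⁻¹) ^ (K - n)) A z ν ∧ ((F.L : ℝ)⁻¹) ^ (K - n) * ‖A z ν‖ ≤ c₁) →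
      (∀ (m : Site (F.P K) 0 → Matrix (Fin 2) (Fin 2) ℂ) (i : ℕ) (y : Site (F.P K) (i + 1)), κf m (i + 1) y = (vframeU (gaugeActT (κf m i) (dbarIterU i (gaugeActT
          (fun s => (u₁ (lift (F.P K) x₀ + rel x₀ s))⁻¹ * Unitary.toUnits (suIncl (gJ s)) : GaugeTransf (F.P K) 0 (Matrix (Fin 2) (Fin 2) ℂ)ˣ)
          (unitsField (toUField U))))) y)⁻¹ * κf m i (emb y) * vframeU (dbarIterU i (gaugeActT
            (fun s => (u₁ (lift (F.P K) x₀ + rel x₀ s))⁻¹ * Unitary.toUnits (suIncl (gJ s)) : GaugeTransf (F.P K) 0 (Matrix (Fin 2) (Fin 2) ℂ)ˣ) (unitsField (toUField U)))) y) →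
      (∀ (m : Site (F.P K) 0 → Matrix (Fin 2) (Fin 2) ℂ) (x : Site (F.P K) 0), ((κf m 0 x : (Matrix (Fin 2) (Fin 2) ℂ)ˣ) : Matrix (Fin 2) (Fin 2) ℂ) = exp (m x)) →
      (∀ x, IsSelfAdjoint (lam x)) → (∀ x, (lam x).trace = 0) → (∀ yc ∈ cubeLamS (F.P K).L a M' ρ' (K - n) (K - n) (K - n),
        κf (((-I) • lam) ∘ fun s : Site (F.P K) 0 => lift (F.P K) x₀ + rel x₀ s) (K - n) (coverAt (F.P K) (K - n) yc) = axialT (dbarIterU (K - n) (gaugeActT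
            (fun s => (u₁ (lift (F.P K) x₀ + rel x₀ s))⁻¹ * Unitary.toUnits (suIncl (gJ s)) : GaugeTransf (F.P K) 0 (Matrix (Fin 2) (Fin 2) ℂ)ˣ)
            (unitsField (toUField U)))) (iterBlockOf (K - n) x₀) (coverAt (F.P K) (K - n) yc)) →
      (∀ j, j ≤ K - n → ∀ b ∈ {b : LSite (F.P K).d × Fin (F.P K).d | SideTouches ((cubeFam false (F.P K).L a M' ρ' (K - n)) j) b.1 b.2},
        ‖lam b.1‖ ≤ α₄ ∧ wt (F.P K).L (((F.L : ℝ)⁻¹) ^ (K - n)) j * ‖covDerivFwd (((F.L : ℝ)⁻¹) ^ (K - n)) (1 : LSite (F.P K).d → Fin (F.P K).d → (Matrix (Fin 2) (Fin 2) ℂ)ˣ) b.2 lam b.1‖ ≤ α₄) →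
      Restr129 (F.P K).L (K - n) (cubeLamS (F.P K).L a M' ρ' (K - n) (K - n)) (1 : LSite (F.P K).d → Fin (F.P K).d → (Matrix (Fin 2) (Fin 2) ℂ)ˣ) u₁ →
      Restr129 (F.P K).L (K - n) (Function.update (cubeLamS (F.P K).L a M' ρ' (K - n) (K - n)) (K - n) ∅) (1 : LSite (F.P K).d → Fin (F.P K).d → (Matrix (Fin 2) (Fin 2) ℂ)ˣ) (u₁ * gaugeExp lam) →
      ∀ yc ∈ cubeLamS (F.P K).L a M' ρ' (K - n) (K - n) (K - n),
        ‖((B7Eq84Concrete.uavg (F.P K).L (1 : LSite (F.P K).d → Fin (F.P K).d → (Matrix (Fin 2) (Fin 2) ℂ)ˣ) (u₁ * gaugeExp lam) (K - n) yc : (Matrix (Fin 2) (Fin 2) ℂ)ˣ) : Matrix (Fin 2) (Fin 2) ℂ) *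
            ((κf (((-I) • lam) ∘ fun s : Site (F.P K) 0 => lift (F.P K) x₀ + rel x₀ s) (K - n) (coverAt (F.P K) (K - n) yc) : (Matrix (Fin 2) (Fin 2) ℂ)ˣ) : Matrix (Fin 2) (Fin 2) ℂ) - 1‖ ≤ θa)
    -- (b-row): the fat-loop STOKES bound on the knit's top frame, `θb` (★w3-19200 g10 ∕ B-al)
    (hStokes : ∀ (gJ : GaugeTransf (F.P K) 0 (Matrix.specialUnitaryGroup (Fin 2) ℂ)) (u₁ : LSite (F.P K).d → (Matrix (Fin 2) (Fin 2) ℂ)ˣ)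
        (W : LSite (F.P K).d → Fin (F.P K).d → (Matrix (Fin 2) (Fin 2) ℂ)ˣ) (A : LSite (F.P K).d → Fin (F.P K).d → Matrix (Fin 2) (Fin 2) ℂ) (c₁ c' : ℝ)
        (κf : (Site (F.P K) 0 → Matrix (Fin 2) (Fin 2) ℂ) → (i : ℕ) → GaugeTransf (F.P K) i (Matrix (Fin 2) (Fin 2) ℂ)ˣ) (lam : LSite (F.P K).d → Matrix (Fin 2) (Fin 2) ℂ),
      InAk (F.P K).L (K - n) (((F.L : ℝ)⁻¹) ^ (K - n)) ε₀ (fun _ => (Set.univ : Set (LSite (F.P K).d))) (pull (unitsField (toUField (GaugeField.gaugeAct gJ U))) 0) →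
      (∀ m', m' ≤ K - n → ∀ Λ : ℕ → Set (LSite (F.P K).d), InAx (F.P K).L m' Λ (1 : LSite (F.P K).d → Fin (F.P K).d → (Matrix (Fin 2) (Fin 2) ℂ)ˣ) (pull (unitsField (toUField (GaugeField.gaugeAct gJ U))) 0)) →
      (∀ m', m' ≤ K - n → ∀ (x : LSite (F.P K).d) (ν : Fin (F.P K).d), tlo (F.P K).L (tLo a ρ') m' ≤ x → x + e ν ≤ thi (F.P K).L (tHi a M' ρ') m' →
        ‖((avgIter (F.P K).L (pull (unitsField (toUField (GaugeField.gaugeAct gJ U))) 0) (K - n - m') x ν : (Matrix (Fin 2) (Fin 2) ℂ)ˣ) : Matrix (Fin 2) (Fin 2) ℂ) - 1‖ < s) →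
      (∀ (x : LSite (F.P K).d) (ν : Fin (F.P K).d), tLo a ρ' ≤ x → x + e ν ≤ tHi a M' ρ' → lowPart ν (x - tLo a ρ') = 0 →
        avgIter (F.P K).L (pull (unitsField (toUField (GaugeField.gaugeAct gJ U))) 0) (K - n) x ν = 1) →
      (∀ z, ((u₁ z : (Matrix (Fin 2) (Fin 2) ℂ)ˣ) : Matrix (Fin 2) (Fin 2) ℂ) ∈ Matrix.specialUnitaryGroup (Fin 2) ℂ) →
      mgauge (1 : LSite (F.P K).d → Fin (F.P K).d → (Matrix (Fin 2) (Fin 2) ℂ)ˣ) u₁ W = pull (unitsField (toUField (GaugeField.gaugeAct gJ U))) 0 →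
      0 ≤ c' → 8 * 3800 * ((((F.P K).d + 2) * (F.P K).L : ℕ) : ℝ) ^ 2 * c' ≤ 1 → Real.exp c₁ - 1 ≤ ((F.L : ℝ)⁻¹) ^ (K - n) * c' →
      (∀ z ∈ cube (F.P K).L a M' ρ' (K - n) (K - n), ∀ ν : Fin (F.P K).d, W z ν = cfgExp (((F.L : ℝ)⁻¹) ^ (K - n)) A z ν ∧ ((F.L : ℝ)⁻¹) ^ (K - n) * ‖A z ν‖ ≤ c₁) →
      (∀ (m : Site (F.P K) 0 → Matrix (Fin 2) (Fin 2) ℂ) (i : ℕ) (y : Site (F.P K) (i + 1)), κf m (i + 1) y = (vframeU (gaugeActT (κf m i) (dbarIterU i (gaugeActT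
          (fun s => (u₁ (lift (F.P K) x₀ + rel x₀ s))⁻¹ * Unitary.toUnits (suIncl (gJ s)) : GaugeTransf (F.P K) 0 (Matrix (Fin 2) (Fin 2) ℂ)ˣ)
          (unitsField (toUField U))))) y)⁻¹ * κf m i (emb y) * vframeU (dbarIterU i (gaugeActT
            (fun s => (u₁ (lift (F.P K) x₀ + rel x₀ s))⁻¹ * Unitary.toUnits (suIncl (gJ s)) : GaugeTransf (F.P K) 0 (Matrix (Fin 2) (Fin 2) ℂ)ˣ) (unitsField (toUField U)))) y) →
      (∀ (m : Site (F.P K) 0 → Matrix (Fin 2) (Fin 2) ℂ) (x : Site (F.P K) 0), ((κf m 0 x : (Matrix (Fin 2) (Fin 2) ℂ)ˣ) : Matrix (Fin 2) (Fin 2) ℂ) = exp (m x)) →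
      (∀ x, IsSelfAdjoint (lam x)) → (∀ x, (lam x).trace = 0) → (∀ yc ∈ cubeLamS (F.P K).L a M' ρ' (K - n) (K - n) (K - n),
        κf (((-I) • lam) ∘ fun s : Site (F.P K) 0 => lift (F.P K) x₀ + rel x₀ s) (K - n) (coverAt (F.P K) (K - n) yc) = axialT (dbarIterU (K - n) (gaugeActT
            (fun s => (u₁ (lift (F.P K) x₀ + rel x₀ s))⁻¹ * Unitary.toUnits (suIncl (gJ s)) : GaugeTransf (F.P K) 0 (Matrix (Fin 2) (Fin 2) ℂ)ˣ)
            (unitsField (toUField U)))) (iterBlockOf (K - n) x₀) (coverAt (F.P K) (K - n) yc)) →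
      (∀ j, j ≤ K - n → ∀ b ∈ {b : LSite (F.P K).d × Fin (F.P K).d | SideTouches ((cubeFam false (F.P K).L a M' ρ' (K - n)) j) b.1 b.2},
        ‖lam b.1‖ ≤ α₄ ∧ wt (F.P K).L (((F.L : ℝ)⁻¹) ^ (K - n)) j * ‖covDerivFwd (((F.L : ℝ)⁻¹) ^ (K - n)) (1 : LSite (F.P K).d → Fin (F.P K).d → (Matrix (Fin 2) (Fin 2) ℂ)ˣ) b.2 lam b.1‖ ≤ α₄) →
      Restr129 (F.P K).L (K - n) (cubeLamS (F.P K).L a M' ρ' (K - n) (K - n)) (1 : LSite (F.P K).d → Fin (F.P K).d → (Matrix (Fin 2) (Fin 2) ℂ)ˣ) u₁ →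
      Restr129 (F.P K).L (K - n) (Function.update (cubeLamS (F.P K).L a M' ρ' (K - n) (K - n)) (K - n) ∅) (1 : LSite (F.P K).d → Fin (F.P K).d → (Matrix (Fin 2) (Fin 2) ℂ)ˣ) (u₁ * gaugeExp lam) →
      ∀ yc ∈ cubeLamS (F.P K).L a M' ρ' (K - n) (K - n) (K - n),
        ‖((axialT (dbarIterU (K - n) (gaugeActT
            (fun s => (u₁ (lift (F.P K) x₀ + rel x₀ s))⁻¹ * Unitary.toUnits (suIncl (gJ s)) : GaugeTransf (F.P K) 0 (Matrix (Fin 2) (Fin 2) ℂ)ˣ)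
            (unitsField (toUField U)))) (iterBlockOf (K - n) x₀) (coverAt (F.P K) (K - n) yc) : (Matrix (Fin 2) (Fin 2) ℂ)ˣ) : Matrix (Fin 2) (Fin 2) ℂ) - 1‖ ≤ θb) :
    ∀ (gJ : GaugeTransf (F.P K) 0 (Matrix.specialUnitaryGroup (Fin 2) ℂ)) (u₁ : LSite (F.P K).d → (Matrix (Fin 2) (Fin 2) ℂ)ˣ)
        (W : LSite (F.P K).d → Fin (F.P K).d → (Matrix (Fin 2) (Fin 2) ℂ)ˣ) (A : LSite (F.P K).d → Fin (F.P K).d → Matrix (Fin 2) (Fin 2) ℂ) (c₁ c' : ℝ)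
        (κf : (Site (F.P K) 0 → Matrix (Fin 2) (Fin 2) ℂ) → (i : ℕ) → GaugeTransf (F.P K) i (Matrix (Fin 2) (Fin 2) ℂ)ˣ) (lam : LSite (F.P K).d → Matrix (Fin 2) (Fin 2) ℂ),
      InAk (F.P K).L (K - n) (((F.L : ℝ)⁻¹) ^ (K - n)) ε₀ (fun _ => (Set.univ : Set (LSite (F.P K).d))) (pull (unitsField (toUField (GaugeField.gaugeAct gJ U))) 0) →
      (∀ m', m' ≤ K - n → ∀ Λ : ℕ → Set (LSite (F.P K).d), InAx (F.P K).L m' Λ (1 : LSite (F.P K).d → Fin (F.P K).d → (Matrix (Fin 2) (Fin 2) ℂ)ˣ) (pull (unitsField (toUField (GaugeField.gaugeAct gJ U))) 0)) →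
      (∀ m', m' ≤ K - n → ∀ (x : LSite (F.P K).d) (ν : Fin (F.P K).d), tlo (F.P K).L (tLo a ρ') m' ≤ x → x + e ν ≤ thi (F.P K).L (tHi a M' ρ') m' →
        ‖((avgIter (F.P K).L (pull (unitsField (toUField (GaugeField.gaugeAct gJ U))) 0) (K - n - m') x ν : (Matrix (Fin 2) (Fin 2) ℂ)ˣ) : Matrix (Fin 2) (Fin 2) ℂ) - 1‖ < s) →
      (∀ (x : LSite (F.P K).d) (ν : Fin (F.P K).d), tLo a ρ' ≤ x → x + e ν ≤ tHi a M' ρ' → lowPart ν (x - tLo a ρ') = 0 →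
        avgIter (F.P K).L (pull (unitsField (toUField (GaugeField.gaugeAct gJ U))) 0) (K - n) x ν = 1) →
      (∀ z, ((u₁ z : (Matrix (Fin 2) (Fin 2) ℂ)ˣ) : Matrix (Fin 2) (Fin 2) ℂ) ∈ Matrix.specialUnitaryGroup (Fin 2) ℂ) →
      mgauge (1 : LSite (F.P K).d → Fin (F.P K).d → (Matrix (Fin 2) (Fin 2) ℂ)ˣ) u₁ W = pull (unitsField (toUField (GaugeField.gaugeAct gJ U))) 0 →
      0 ≤ c' → 8 * 3800 * ((((F.P K).d + 2) * (F.P K).L : ℕ) : ℝ) ^ 2 * c' ≤ 1 → Real.exp c₁ - 1 ≤ ((F.L : ℝ)⁻¹) ^ (K - n) * c' →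
      (∀ z ∈ cube (F.P K).L a M' ρ' (K - n) (K - n), ∀ ν : Fin (F.P K).d, W z ν = cfgExp (((F.L : ℝ)⁻¹) ^ (K - n)) A z ν ∧ ((F.L : ℝ)⁻¹) ^ (K - n) * ‖A z ν‖ ≤ c₁) →
      (∀ (m : Site (F.P K) 0 → Matrix (Fin 2) (Fin 2) ℂ) (i : ℕ) (y : Site (F.P K) (i + 1)), κf m (i + 1) y = (vframeU (gaugeActT (κf m i) (dbarIterU i (gaugeActT
          (fun s => (u₁ (lift (F.P K) x₀ + rel x₀ s))⁻¹ * Unitary.toUnits (suIncl (gJ s)) : GaugeTransf (F.P K) 0 (Matrix (Fin 2) (Fin 2) ℂ)ˣ)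
          (unitsField (toUField U))))) y)⁻¹ * κf m i (emb y) * vframeU (dbarIterU i (gaugeActT
            (fun s => (u₁ (lift (F.P K) x₀ + rel x₀ s))⁻¹ * Unitary.toUnits (suIncl (gJ s)) : GaugeTransf (F.P K) 0 (Matrix (Fin 2) (Fin 2) ℂ)ˣ) (unitsField (toUField U)))) y) →
      (∀ (m : Site (F.P K) 0 → Matrix (Fin 2) (Fin 2) ℂ) (x : Site (F.P K) 0), ((κf m 0 x : (Matrix (Fin 2) (Fin 2) ℂ)ˣ) : Matrix (Fin 2) (Fin 2) ℂ) = exp (m x)) →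
      (∀ x, IsSelfAdjoint (lam x)) → (∀ x, (lam x).trace = 0) → (∀ yc ∈ cubeLamS (F.P K).L a M' ρ' (K - n) (K - n) (K - n),
        κf (((-I) • lam) ∘ fun s : Site (F.P K) 0 => lift (F.P K) x₀ + rel x₀ s) (K - n) (coverAt (F.P K) (K - n) yc) = axialT (dbarIterU (K - n) (gaugeActT
            (fun s => (u₁ (lift (F.P K) x₀ + rel x₀ s))⁻¹ * Unitary.toUnits (suIncl (gJ s)) : GaugeTransf (F.P K) 0 (Matrix (Fin 2) (Fin 2) ℂ)ˣ)
            (unitsField (toUField U)))) (iterBlockOf (K - n) x₀) (coverAt (F.P K) (K - n) yc)) →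
      (∀ j, j ≤ K - n → ∀ b ∈ {b : LSite (F.P K).d × Fin (F.P K).d | SideTouches ((cubeFam false (F.P K).L a M' ρ' (K - n)) j) b.1 b.2},
        ‖lam b.1‖ ≤ α₄ ∧ wt (F.P K).L (((F.L : ℝ)⁻¹) ^ (K - n)) j * ‖covDerivFwd (((F.L : ℝ)⁻¹) ^ (K - n)) (1 : LSite (F.P K).d → Fin (F.P K).d → (Matrix (Fin 2) (Fin 2) ℂ)ˣ) b.2 lam b.1‖ ≤ α₄) →
      Restr129 (F.P K).L (K - n) (cubeLamS (F.P K).L a M' ρ' (K - n) (K - n)) (1 : LSite (F.P K).d → Fin (F.P K).d → (Matrix (Fin 2) (Fin 2) ℂ)ˣ) u₁ →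
      Restr129 (F.P K).L (K - n) (Function.update (cubeLamS (F.P K).L a M' ρ' (K - n) (K - n)) (K - n) ∅) (1 : LSite (F.P K).d → Fin (F.P K).d → (Matrix (Fin 2) (Fin 2) ℂ)ˣ) (u₁ * gaugeExp lam) →
      ∀ (u : LSite (F.P K).d → (Matrix (Fin 2) (Fin 2) ℂ)ˣ) (V' : LSite (F.P K).d → Fin (F.P K).d → (Matrix (Fin 2) (Fin 2) ℂ)ˣ) (A' : LSite (F.P K).d → Fin (F.P K).d → (Matrix (Fin 2) (Fin 2) ℂ)),
      (∀ x, u x ∈ unitaryUnits (Matrix (Fin 2) (Fin 2) ℂ)) → mgauge (1 : LSite (F.P K).d → Fin (F.P K).d → (Matrix (Fin 2) (Fin 2) ℂ)ˣ) u V' = (pull (unitsField (toUField (GaugeField.gaugeAct gJ U))) 0) →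
      Restr129 (F.P K).L (K - n) (Function.update (cubeLamS (F.P K).L a M' ρ' (K - n) (K - n)) (K - n) ∅) (1 : LSite (F.P K).d → Fin (F.P K).d → (Matrix (Fin 2) (Fin 2) ℂ)ˣ) u →
      (IsLandau138W (F.P K).L (K - n) (((F.L : ℝ)⁻¹) ^ (K - n)) ((cubeFam false (F.P K).L a M' ρ' (K - n)) 0) (cubeLamS (F.P K).L a M' ρ' (K - n) (K - n)) (1 : LSite (F.P K).d → Fin (F.P K).d → (Matrix (Fin 2) (Fin 2) ℂ)ˣ) V' ∧
        (∀ c ∈ (cubeLamBP' (F.P K).L a M' ρ' (K - n) (K - n)) (K - n), ∀ (y : LSite (F.P K).d) (τ : Fin (F.P K).d),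
          InBox (loK (F.P K).L (K - n) c.1) (bondHiK (F.P K).L (K - n) c.1 c.2) y → InBox (loK (F.P K).L (K - n) c.1) (bondHiK (F.P K).L (K - n) c.1 c.2) (y + e τ) →
          V' y τ = gaugeActT (fun s => ((u₁ * gaugeExp lam) (lift (F.P K) x₀ + rel x₀ s))⁻¹ * Unitary.toUnits (suIncl (gJ s)) : GaugeTransf (F.P K) 0 (Matrix (Fin 2) (Fin 2) ℂ)ˣ) (unitsField (toUField U)) ⟨cover (F.P K) y, τ⟩)) →
      (∀ y τ, IsSelfAdjoint (A' y τ)) → (∀ j, j ≤ K - n → ∀ y τ, SideTouches ((cubeFam false (F.P K).L a M' ρ' (K - n)) j) y τ →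
        V' y τ = cfgExp (((F.L : ℝ)⁻¹) ^ (K - n)) A' y τ ∧ ‖A' y τ‖ ≤ (2 * ((F.P K).L * cstar) + 8 * α₄) * (((F.P K).L : ℝ) ^ j * (((F.L : ℝ)⁻¹) ^ (K - n)))⁻¹) →
      (∀ y τ, (∀ j, j ≤ K - n → ¬ SideTouches ((cubeFam false (F.P K).L a M' ρ' (K - n)) j) y τ) → A' y τ = 0) →
      ∀ c ∈ (cubeLamBP' (F.P K).L a M' ρ' (K - n) (K - n)) (K - n), c ∉ (cubeLamB (F.P K).L a M' ρ' (K - n) (K - n)) (K - n) →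
        ‖logCovIter (F.P K).L (1 : LSite (F.P K).d → Fin (F.P K).d → (Matrix (Fin 2) (Fin 2) ℂ)ˣ) (iEta (((F.L : ℝ)⁻¹) ^ (K - n)) A') (K - n) c.1 c.2‖ < 2 * (F.P K).d * (F.P K).L * α₁ := by
  letI : CStarAlgebra (Matrix (Fin 2) (Fin 2) ℂ) := {}
  intro gJ u₁ W A c₁ c' κf lam hInAk hInAx htw havg1 hu₁SU hWmg hc'0 hbud hc₁ hchartTop hκfs hκf0 hsalam htrlam htopId h108 h129u₁ h129
    u V' A' hu hV' h129u hLanKnit hsa' hWA' hA0 c hc hnot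
  have hArow := hDict gJ u₁ W A c₁ c' κf lam hInAk hInAx htw havg1 hu₁SU hWmg hc'0 hbud hc₁ hchartTop hκfs hκf0 hsalam htrlam htopId h108 h129u₁ h129
  have hBrow := hStokes gJ u₁ W A c₁ c' κf lam hInAk hInAx htw havg1 hu₁SU hWmg hc'0 hbud hc₁ hchartTop hκfs hκf0 hsalam htrlam htopId h108 h129u₁ h129
  clear hDict hStokes
  have hd2 : 2 ≤ (F.P K).d := by rw [T3Family.P_d]; norm_num
  have hL2 : 2 ≤ (F.P K).L := by have := F.hL.2; exact this
  have hL1 : 1 ≤ (F.P K).L := (F.P K).L_pos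
  have hKn : n < K := hnK
  have hk1 : 1 ≤ K - n := le_trans (by norm_num) h2
  have hk : K - n ≤ (F.P K).m + (F.P K).K := FlatMinimizerH.le_T3 F n K
  have hρ'1 : 1 ≤ ρ' := hL1.trans hρL
  have hL0 : (0 : ℝ) < (F.L : ℝ) := by have := F.hL.2; exact_mod_cast (by omega : 0 < F.L)
  have hη : (0 : ℝ) < ((F.L : ℝ)⁻¹) ^ (K - n) := pow_pos (inv_pos.2 hL0) _
  have hα₂ : 0 ≤ 2 * ((F.P K).L * cstar) + 8 * α₄ := by positivity
  have hθ0 : 0 ≤ θa + 2 * θb * (1 + θa) := by positivity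
  have hθb2 : θb ≤ 1 / 2 := by nlinarith
  have hM'0 : (0 : ℤ) ≤ (M' : ℤ) - 1 := by have := hM'; omega
  set U' : LSite (F.P K).d → Fin (F.P K).d → (Matrix (Fin 2) (Fin 2) ℂ)ˣ := pull (unitsField (toUField (GaugeField.gaugeAct gJ U))) 0 with hU'
  have h135c := h135_cubeMember_γ (P := F.P K) (𝔸 := (Matrix (Fin 2) (Fin 2) ℂ)) hL2 a M' hρ'1 htw
  have h135 : ∀ (z : LSite (F.P K).d) (μ : Fin (F.P K).d),
      (∀ x, InBox (loK (F.P K).L (K - n) z) (bondHiK (F.P K).L (K - n) z μ) x → x ∈ cubeFam false (F.P K).L a M' ρ' (K - n) (K - n - 1)) →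
      ‖(avgIter (F.P K).L U' (K - n) z μ : Matrix (Fin 2) (Fin 2) ℂ) - 1‖ ≤ s := by
    intro z μ hb
    have h := h135c (K - n) le_rfl z μ hb
    rwa [HalvingP1FlatCoreSupplierInduction.mulCfg_one_right, B8Ineq132.avgIter_one, Pi.one_apply, Pi.one_apply, Units.val_one] at h
  have hAx : ∀ Λ : ℕ → Set (LSite (F.P K).d), InAx (F.P K).L (K - n) Λ (1 : LSite (F.P K).d → Fin (F.P K).d → (Matrix (Fin 2) (Fin 2) ℂ)ˣ) U' :=
    fun Λ => hInAx (K - n) le_rfl Λ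
  have hkk : cubeFam false (F.P K).L a M' ρ' (K - n) (K - n - 1) = cube (F.P K).L a M' ρ' (K - n) (K - n - 1) :=
    cubeFam_false_of_le _ _ _ _ (Nat.sub_le _ _)
  have hWU : ∀ c ∈ cubeLamBP' (F.P K).L a M' ρ' (K - n) (K - n) (K - n),
      AgreeOn (loK (F.P K).L (K - n) c.1) (bondHiK (F.P K).L (K - n) c.1 c.2)
        (mgauge (1 : LSite (F.P K).d → Fin (F.P K).d → (Matrix (Fin 2) (Fin 2) ℂ)ˣ) (u₁ * gaugeExp lam) V') U' := by
    intro c hc y τ hy hyτ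
    have hV := hLanKnit.2 c hc y τ hy hyτ
    have hboxP := cubeLamBP'_hbox_pred (d := (F.P K).d) hL1 a M' hρL (K - n) (K - n) le_rfl (K - n) le_rfl c hc
    have hy0 : y ∈ cube (F.P K).L a M' ρ' (K - n) 0 := cube_anti (Nat.zero_le _) (Nat.sub_le _ _) (hkk ▸ hboxP y hy)
    have hyτ0 : y + e τ ∈ cube (F.P K).L a M' ρ' (K - n) 0 := cube_anti (Nat.zero_le _) (Nat.sub_le _ _) (hkk ▸ hboxP (y + e τ) hyτ)
    have hz1 : lift (F.P K) x₀ + rel x₀ (cover (F.P K) y) = y := rep_cover_eq_of_mem_cube hk x₀ ha hroomW hy0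
    have hz2 : lift (F.P K) x₀ + rel x₀ ((cover (F.P K) y).shift τ) = y + e τ := by
      rw [← transl_zero_eq_cover, ← transl_add_e, transl_zero_eq_cover]; exact rep_cover_eq_of_mem_cube hk x₀ ha hroomW hyτ0
    have hwin' : gaugeActT (fun s => ((u₁ * gaugeExp lam) (lift (F.P K) x₀ + rel x₀ s))⁻¹ * Unitary.toUnits (suIncl (gJ s)) :
          GaugeTransf (F.P K) 0 (Matrix (Fin 2) (Fin 2) ℂ)ˣ) (unitsField (toUField U)) ⟨cover (F.P K) y, τ⟩ =
        ((u₁ * gaugeExp lam) y)⁻¹ * gaugeActT (fun s => Unitary.toUnits (suIncl (gJ s))) (unitsField (toUField U)) ⟨cover (F.P K) y, τ⟩ *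
          (u₁ * gaugeExp lam) (y + e τ) := by
      rw [gaugeActT_mul_left (fun s => ((u₁ * gaugeExp lam) (lift (F.P K) x₀ + rel x₀ s))⁻¹) (fun s => Unitary.toUnits (suIncl (gJ s)))
        (unitsField (toUField U)) ⟨cover (F.P K) y, τ⟩]
      simp only [PBond.tgt, hz1, hz2, inv_inv]
    show mgauge (1 : LSite (F.P K).d → Fin (F.P K).d → (Matrix (Fin 2) (Fin 2) ℂ)ˣ) (u₁ * gaugeExp lam) V' y τ =
      pull (unitsField (toUField (GaugeField.gaugeAct gJ U))) 0 y τ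
    rw [mgauge_apply, Pi.one_apply, Pi.one_apply, Rc_one_apply, hV, hwin', pull_apply, unitsField_toUField_gaugeAct, transl_zero_eq_cover]
    group
  have hdef : ∀ yc ∈ cubeLamS (F.P K).L a M' ρ' (K - n) (K - n) (K - n),
      ‖(uavg (F.P K).L (1 : LSite (F.P K).d → Fin (F.P K).d → (Matrix (Fin 2) (Fin 2) ℂ)ˣ) (u₁ * gaugeExp lam) (K - n) yc : Matrix (Fin 2) (Fin 2) ℂ) - 1‖
        ≤ θa + 2 * θb * (1 + θa) := by
    intro yc hyc
    have ha' := hArow yc hyc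
    have hb' := hBrow yc hyc
    rw [← htopId yc hyc] at hb'
    exact norm_sub_one_le_of_mul_right hθa hθb2 ha' hb'
  exact H42cross_of_defect hd2 hη hL2 a M' hρL hk1 hε₀ hα₂ hα3γ hα4γ hsmallPγ hc₃Pγ U' hAx hs0 hθ0 hhalf hwin h135
    (u₁ * gaugeExp lam) V' A' hWU h129 hdef hWA' c hc hnot

end Summit.QuantumFields.YangMills.Theorems.HalvingH42TopCrossAssembly

end
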